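import Mathlib
import HarnessLib
import Summits.Ventures.LatticeQCDFlow.Scoring.ReplicaChains
import Summits.Ventures.LatticeQCDFlow.Scoring.ChainBurnInDiscard

/-!
# The production recipe, certified: `R` independent streams, a burn-in cut of `B`, `N` kept samples —
# `E[(grand mean − πf)²] ≤ ((2/ε − 1) Var_π f/N + 16C'²(1−ε/2)^B/(ε²N²))/R + (1 − 1/R)(2C'(1−ε/2)^B/(εN))²`

HONEST FRAMING: exact (Metropolis-corrected) sampling algorithms for lattice gauge theory;
figures of merit are autocorrelation/cost numbers at stated couplings and volumes; no
continuum-physics claim.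

Venture `LatticeQCDFlow` (cell pub-lqcd), topic `Scoring`; FANOUT row 8 (`s0-cpn-nemc`, GEN-14).
NEW WORK of the cell, not a published result; no definition is introduced.  `Scoring/ReplicaChains.lean`
showed that independent streams divide the fluctuation term of the mean-square error by `R` but
leave the weight `1 − 1/R` on the squared burn-in bias; `Scoring/ChainBurnInDiscard.lean` showed what
a cut of `B` samples buys ONE stream.  This file puts the two together for the way parallel exact
samplers are run (every stream discards `B`, keeps `N`; streams pairwise independent, arbitrary and
possibly different starts): the bias term that replicas cannot divide is the one the cut kills
geometrically.  Inputs: `Scoring/ChainBurnIn.chain_bias_le_of_doeblin` (per-step bias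
`(1 − ε/2)ᵗ C'`), `Scoring/ChainBurnInDiscard.chain_mse_shifted_le_of_doeblin`,
`Scoring/ReplicaChains.integral_replicaMean_sub_sq_le`.  Nothing is cited as a fact; printed
counterpart NAMED ONLY: the many-short-chains regime (Margossian et al. 2024, nested `R̂`).

## Content (`κ` Markov, `π` invariant, `κ(x, ·) ≥ ε π`, `ε > 0`; `|f| ≤ C`, `C' = C + |πf|`;
## `A_{B,N} = (1/N) Σ_{i<N} f(X_{B+i})`, `N ≥ 1`)

* **`chain_timeAverage_shifted_bias_le_of_doeblin`** — from ANY start,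
  `|E_{μ₀}[A_{B,N}] − πf| ≤ 2 C' (1 − ε/2)^B/(ε N)`;
* **`replicaChains_burnIn_mse_le_of_doeblin`** — `R ≥ 1` pairwise independent streams `X_r` with
  laws `trajMeasure (μ₀ r) κ` on any probability space, `Ȳ` the grand mean of the `A_{B,N}(X_r)`:
  `E[(Ȳ − πf)²] ≤ ((2/ε − 1) Var_π f/N + 16 C'² (1−ε/2)^B/(ε² N²))/R + (1 − 1/R) (2C'(1−ε/2)^B/(εN))²`.

Reading (value-free): at fixed kept length `N` the three knobs separate — `R` divides the
fluctuation `(2/ε − 1)Var_π f/N`, `B` multiplies every start-dependent term by `(1 − ε/2)^B`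
(squared: `(1 − ε/2)^{2B}` on the cross-stream bias), and nothing else moves; a certificate `ε` thus
turns (streams, burn-in, kept length) into an honest error budget from cold starts.  NOT CLAIMED:
any `ε` for a concrete sampler; optimality of the split between `B` and `N`; unbounded observables.
-/

noncomputable section

namespace Summit.Ventures.LatticeQCDFlow.Scoring

open MeasureTheory ProbabilityTheory Filter Finset
open scoped ENNReal

variable {Ω : Type*} [MeasurableSpace Ω]
variable {κ : Kernel Ω Ω} [IsMarkovKernel κ] {π : Measure Ω} [IsProbabilityMeasure π] {ε : ℝ≥0∞}

section OneStream

variable {μ₀ : Measure Ω} [IsProbabilityMeasure μ₀]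

/-- **Bias of the time average after a burn-in cut, any start**:
`|E_{μ₀}[(1/N) Σ_{i<N} f(X_{B+i})] − πf| ≤ 2 (C + |πf|) (1 − ε/2)^B / (ε N)`. -/
theorem chain_timeAverage_shifted_bias_le_of_doeblin (hπ : Kernel.Invariant κ π)
    (hmin : ∀ x {B : Set Ω}, MeasurableSet B → ε * π B ≤ κ x B) (hε0 : 0 < ε)
    {f : Ω → ℝ} (hf : Measurable f) {C : ℝ} (hC : ∀ x, |f x| ≤ C) (B : ℕ) {N : ℕ} (hN : N ≠ 0) :
    |∫ x, (∑ i ∈ Finset.range N, f (x (B + i))) / N ∂(Kernel.trajMeasure (X := fun _ : ℕ => Ω) μ₀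
        (fun n : ℕ => κ.comap (fun h : (i : ↥(Finset.Iic n)) → Ω => h ⟨n, Finset.mem_Iic.2 le_rfl⟩)
          (measurable_pi_apply _))) - ∫ x, f x ∂π|
      ≤ 2 * (C + |∫ x, f x ∂π|) * (1 - (ε / 2).toReal) ^ B / (ε.toReal * N) := by
  set P := Kernel.trajMeasure (X := fun _ : ℕ => Ω) μ₀
      (fun n : ℕ => κ.comap (fun h : (i : ↥(Finset.Iic n)) → Ω => h ⟨n, Finset.mem_Iic.2 le_rfl⟩)
        (measurable_pi_apply _)) with hP
  set m := ∫ x, f x ∂π with hm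
  set r := 1 - (ε / 2).toReal with hr
  obtain ⟨-, hl0, hl1, -, -, hεr0⟩ := half_const_bounds hmin hε0
  have hNpos : (0 : ℝ) < N := by exact_mod_cast Nat.pos_of_ne_zero hN
  have hCm : 0 ≤ C + |m| := by
    obtain ⟨x⟩ := nonempty_of_isProbabilityMeasure π
    exact add_nonneg ((abs_nonneg _).trans (hC x)) (abs_nonneg _)
  have hint : ∀ i, Integrable (fun x : ℕ → Ω => f (x (B + i))) P := fun i =>
    integrable_of_bounded P (hf.comp (measurable_pi_apply (B + i))) fun x => hC (x (B + i))
  have hstep : ∀ i, |∫ x, f (x (B + i)) ∂P - m| ≤ r ^ (B + i) * (C + |m|) := fun i => by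
    rw [hP]; exact chain_bias_le_of_doeblin (μ₀ := μ₀) hπ hmin hε0 hf hC (B + i)
  have hmean : ∫ x, (∑ i ∈ Finset.range N, f (x (B + i))) / N ∂P
      = (∑ i ∈ Finset.range N, ∫ x, f (x (B + i)) ∂P) / N := by
    rw [integral_div, integral_finsetSum _ (fun i _ => hint i)]
  rw [hmean]
  have hsub : (∑ i ∈ Finset.range N, ∫ x, f (x (B + i)) ∂P) / N - m
      = (∑ i ∈ Finset.range N, (∫ x, f (x (B + i)) ∂P - m)) / N := by
    rw [Finset.sum_sub_distrib, Finset.sum_const, Finset.card_range, nsmul_eq_mul]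
    field_simp
  rw [hsub, abs_div, abs_of_pos hNpos]
  -- Σ_i r^{B+i} ≤ r^B · 2/ε
  have hgeo : ∑ i ∈ Finset.range N, r ^ (B + i) ≤ r ^ B * (2 / ε.toReal) := by
    have hlt1 : |r| < 1 := by rw [abs_of_nonneg hl0]; exact hl1
    have hs := sum_le_hasSum (Finset.range N) (fun i _ => pow_nonneg hl0 i)
      (hasSum_geometric_of_abs_lt_one hlt1)
    have hinv : (1 - r)⁻¹ = 2 / ε.toReal := by
      rw [hr, sub_sub_cancel, ENNReal.toReal_div, ENNReal.toReal_ofNat]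
      field_simp
    calc ∑ i ∈ Finset.range N, r ^ (B + i) = r ^ B * ∑ i ∈ Finset.range N, r ^ i := by
          rw [Finset.mul_sum]; exact Finset.sum_congr rfl fun i _ => pow_add r B i
      _ ≤ r ^ B * (1 - r)⁻¹ := mul_le_mul_of_nonneg_left hs (pow_nonneg hl0 B)
      _ = r ^ B * (2 / ε.toReal) := by rw [hinv]
  calc |∑ i ∈ Finset.range N, (∫ x, f (x (B + i)) ∂P - m)| / N
      ≤ (∑ i ∈ Finset.range N, r ^ (B + i) * (C + |m|)) / N := by
        refine div_le_div_of_nonneg_right ((Finset.abs_sum_le_sum_abs _ _).trans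
          (Finset.sum_le_sum fun i _ => hstep i)) hNpos.le
    _ = (C + |m|) * (∑ i ∈ Finset.range N, r ^ (B + i)) / N := by
        rw [← Finset.sum_mul, mul_comm]
    _ ≤ (C + |m|) * (r ^ B * (2 / ε.toReal)) / N :=
        div_le_div_of_nonneg_right (mul_le_mul_of_nonneg_left hgeo hCm) hNpos.le
    _ = 2 * (C + |m|) * r ^ B / (ε.toReal * N) := by
        field_simp

end OneStream

section Streams

variable {Ω' : Type*} {mΩ' : MeasurableSpace Ω'} {μ : Measure Ω'} [IsProbabilityMeasure μ]
  {X : ℕ → Ω' → (ℕ → Ω)} {μ₀ : ℕ → Measure Ω} [∀ r, IsProbabilityMeasure (μ₀ r)] {R : ℕ}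

omit [IsProbabilityMeasure μ] in
/-- A replica time average over the window `B, …, B+N−1` of a bounded observable is square
integrable. -/
theorem memLp_replica_timeAverage_shifted {f : Ω → ℝ} (hf : Measurable f) {C : ℝ}
    (hC : ∀ x, |f x| ≤ C) (B : ℕ) {N : ℕ} (hN : N ≠ 0) [IsFiniteMeasure μ]
    (hXm : ∀ r, Measurable (X r)) (r : ℕ) :
    MemLp (fun ω => (∑ i ∈ Finset.range N, f (X r ω (B + i))) / N) 2 μ := by
  have hAm : Measurable fun x : ℕ → Ω => (∑ i ∈ Finset.range N, f (x (B + i))) / N :=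
    (Finset.measurable_sum _ fun i _ => hf.comp (measurable_pi_apply (B + i))).div_const _
  refine MemLp.of_bound (hAm.comp (hXm r)).aestronglyMeasurable C (ae_of_all _ fun ω => ?_)
  rw [Real.norm_eq_abs]
  exact abs_timeAverage_le (f := f) hC hN (fun j => X r ω (B + j))

/-- **THE PRODUCTION RECIPE, CERTIFIED.**  `π` invariant for `κ`, `κ(x, ·) ≥ ε π` (`ε > 0`),
`|f| ≤ C`, `C' = C + |πf|`, `N ≥ 1`, `R ≥ 1`, a burn-in cut `B`.  On a probability space carrying
pairwise independent paths `X_0, …, X_{R−1}` with laws `trajMeasure (μ₀ r) κ` (arbitrary starts), the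
grand mean `Ȳ` of the stream averages `(1/N) Σ_{i<N} f(X_r (B+i))` satisfies
`E[(Ȳ − πf)²] ≤ ((2/ε − 1) Var_π f/N + 16 C'²(1−ε/2)^B/(ε²N²))/R + (1 − 1/R)(2C'(1−ε/2)^B/(εN))²`. -/
theorem replicaChains_burnIn_mse_le_of_doeblin (hπ : Kernel.Invariant κ π)
    (hmin : ∀ x {B : Set Ω}, MeasurableSet B → ε * π B ≤ κ x B) (hε0 : 0 < ε)
    {f : Ω → ℝ} (hf : Measurable f) {C : ℝ} (hC : ∀ x, |f x| ≤ C) (B : ℕ) {N : ℕ} (hN : N ≠ 0)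
    (hR : R ≠ 0) (hXm : ∀ r, Measurable (X r))
    (hlaw : ∀ r < R, μ.map (X r) = Kernel.trajMeasure (X := fun _ : ℕ => Ω) (μ₀ r)
      (fun n : ℕ => κ.comap (fun h : (i : ↥(Finset.Iic n)) → Ω => h ⟨n, Finset.mem_Iic.2 le_rfl⟩)
        (measurable_pi_apply _)))
    (hind : ∀ i < R, ∀ j < R, i ≠ j → IndepFun (X i) (X j) μ) :
    ∫ ω, (replicaMean (fun r ω => (∑ i ∈ Finset.range N, f (X r ω (B + i))) / N) R ω
        - ∫ z, f z ∂π) ^ 2 ∂μ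
      ≤ ((2 / ε.toReal - 1) * (∫ z, (f z - ∫ y, f y ∂π) ^ 2 ∂π) / N
            + 16 * (C + |∫ z, f z ∂π|) ^ 2 * (1 - (ε / 2).toReal) ^ B
              / (ε.toReal ^ 2 * (N : ℝ) ^ 2)) / R
        + (1 - 1 / R) * (2 * (C + |∫ z, f z ∂π|) * (1 - (ε / 2).toReal) ^ B / (ε.toReal * N)) ^ 2 := by
  have hAm : Measurable fun x : ℕ → Ω => (∑ i ∈ Finset.range N, f (x (B + i))) / N :=
    (Finset.measurable_sum _ fun i _ => hf.comp (measurable_pi_apply (B + i))).div_const _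
  have hY2 : ∀ r < R, MemLp (fun ω => (∑ i ∈ Finset.range N, f (X r ω (B + i))) / N) 2 μ :=
    fun r _ => memLp_replica_timeAverage_shifted hf hC B hN hXm r
  have hb : ∀ r < R, |μ[fun ω => (∑ i ∈ Finset.range N, f (X r ω (B + i))) / N] - ∫ z, f z ∂π|
      ≤ 2 * (C + |∫ z, f z ∂π|) * (1 - (ε / 2).toReal) ^ B / (ε.toReal * N) := by
    intro r hr
    have h := integral_comp_eq_of_map_eq (hXm r) (hlaw r hr) hAm
    rw [show μ[fun ω => (∑ i ∈ Finset.range N, f (X r ω (B + i))) / N]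
        = ∫ ω, (∑ i ∈ Finset.range N, f (X r ω (B + i))) / N ∂μ from rfl, h]
    exact chain_timeAverage_shifted_bias_le_of_doeblin (μ₀ := μ₀ r) hπ hmin hε0 hf hC B hN
  have hv : ∀ r < R, ∫ ω, ((∑ i ∈ Finset.range N, f (X r ω (B + i))) / N - ∫ z, f z ∂π) ^ 2 ∂μ
      ≤ (2 / ε.toReal - 1) * (∫ z, (f z - ∫ y, f y ∂π) ^ 2 ∂π) / N
        + 16 * (C + |∫ z, f z ∂π|) ^ 2 * (1 - (ε / 2).toReal) ^ B
          / (ε.toReal ^ 2 * (N : ℝ) ^ 2) := by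
    intro r hr
    have h := integral_comp_eq_of_map_eq (hXm r) (hlaw r hr)
      (φ := fun x : ℕ → Ω => ((∑ i ∈ Finset.range N, f (x (B + i))) / N - ∫ z, f z ∂π) ^ 2)
      ((hAm.sub measurable_const).pow_const 2)
    rw [h]
    have h2 := chain_mse_shifted_le_of_doeblin (μ₀ := μ₀ r) hπ hmin hε0 hf hC B hN
    rw [autocov_zero] at h2
    exact h2
  have hcov : ∀ a < R, ∀ b < R, a ≠ b →
      cov[fun ω => (∑ i ∈ Finset.range N, f (X a ω (B + i))) / N,
        fun ω => (∑ i ∈ Finset.range N, f (X b ω (B + i))) / N; μ] = 0 := fun a ha b hb' hab =>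
    ((hind a ha b hb' hab).comp hAm hAm).covariance_eq_zero (hY2 a ha) (hY2 b hb')
  exact integral_replicaMean_sub_sq_le
    (Y := fun r ω => (∑ i ∈ Finset.range N, f (X r ω (B + i))) / N) hR hY2 hcov hb hv

end Streams

end Summit.Ventures.LatticeQCDFlow.Scoring

end
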